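/- Copyright: the b2b-balaban cell (near-miss cell 7), T⁴-continuum fan-out, lineage t4-ne7b-p1 (node U5c COUNT
member).  Released under the licence of the surrounding project. -/
import Summits.QuantumFields.BalabanUV.T4Continuum.Support.HistoryGenealogyExtractionR
import Summits.QuantumFields.BalabanUV.T4Continuum.Support.HistoryGenForest
import Summits.QuantumFields.BalabanUV.T4Continuum.Support.HistoryGenBridge

/-!
# THE PEDIGREE OF A COMPONENT HISTORY (junction M4, brick 2a — structural half): from print's level-indexed component
bookkeeping `ComponentHistory` with per-part renewal flags to the END's `HistoryGen.Pedigree` currency, with the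
encoding facts `renew_step`, `UniqueParent`, `OldNodup` and hence `Forest` PROVED (owner module of row NE7b, lineage
`t4-ne7b-p1` gen 41; re-open object (α), `SCOPE-alpha.md` v2.2 §5 row M4, design memo D-M4-1…4, journal l.26866 —
PRE-POSITIONING ONLY)

Summits-side support leaf of the T⁴-continuum cell (rung (B)+1 on a FINITE torus only; NOT infinite volume, NOT the
mass gap, NOT the Clay statement; NOT a proof of the spine estimate NE7b, which is the cell's OWN estimate, NOT PRINTED
and NOT PROVED).  [folklore] finite combinatorics over row S13∕S13-R (`ComponentHistory`, `WF`, `lefts`∕`rights`,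
`parts`∕`news`, `pgenR`) and the END's pedigree layer (`HistoryGen.Pedigree`, `Part`, `toPGen`, `UniqueParent`,
`OldNodup`, `Forest`, `forest_of_uniqueParent`); PROCESS-AGNOSTIC (no geometry, no flow, no readiness convention);
nothing printed is asserted, no `def … : Prop` fact of Bałaban's, no cite-tagged hypothesis, zero `sorry`.  B16 =
[Balaban1989LargeFieldII] pp. 384–387 is a manuscript UNDER AUDIT; locators only.

WHY.  The END of the COUNT road (`HistoryRealiseCells*` carriers, `RealisedDomains*`) reads the live structures of a
term through a `Pedigree α π` (component names `α`, birth payloads `π`): `step`, the `parts` list of every component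
(OLDEST LINE FIRST), `step_lt`; and asks the encoding facts `renew_step` (a renewed part is a component of the PREVIOUS
step), `forest`, `headOldest`, then `real`∕`track`∕`disjoint`∕`inBox` of `toPGen`.  Rows S13-R∕S14-R∕S15 deliver print's
process as a `ComponentHistory γ` with flags `rnw` (and its realisation).  THIS FILE is the order-free, geometry-free
part of the junction: names `α := ℕ × γ` (level, label), payloads `π := γ`, `step := Prod.fst`, `parts (j+1, c)` := the
constituents of `c` in a CHOSEN order `ord (j+1) c` (a permutation of `constit (j+1) c` — the oldest-first contact order
is supplied by brick 2b; here it is a parameter) read as parts: `Sum.inl p ↦ Part.old (j, p) (rnw j p)`, `Sum.inr n ↦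
Part.new (cls n) n`; at level `0` only births.  PROVED: `step_lt` (definitionally), `renew_step`, `UniqueParent` (from
`WF.parts_disj`), `OldNodup` (from `WF.parts_nodup`∕`news_nodup`), hence **`Forest`** for every component — three of
the END's encoding fields — and the one-step unfoldings of `toPGen` in print's trichotomy (lone unflagged part ↦ the
part's `toPGen`; lone flagged part ↦ `renew _ j`; lone new region ↦ `birth`; otherwise the left-nested `chainJoin` at the
level).  Sibling `…PedigreeTiming`: `lastStep`∕`rootStep ≤ level` read off, and a decided toy.

HONEST.  Proves nothing of Bałaban's; `headOldest` (brick 2b, needs the oldest-first order and the displayed condition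
«no fresh clusters», located open point G-M4-1), `real` (brick 2c, over `RealisesW`), `track`∕`inBox` (brick 3) are NOT
here; NE7b NOT proved; spine 0∕9.  HONEST DEPENDENCY (cell): continuum YM on T⁴ ⇐ BetaPertH ∧ nine spine estimates (0/9
proved); BetaPertH ⇐ (D1) ∧ (D4) ∧ CAP+tail; G-an2-4 gates asym, D1 and NE2/3/4.  This file changes none of it. -/

open Finset
open Literature.MathematicalPhysics.QuantumFieldTheory.Balaban1983to89
open Summit.QuantumFields.BalabanUV.T4Continuum.HistoryAdmissible
open Summit.QuantumFields.BalabanUV.T4Continuum.HistoryGen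
open Summit.QuantumFields.BalabanUV.T4Continuum.HistoryGenealogyExtraction

namespace Summit.QuantumFields.BalabanUV.T4Continuum.HistoryGenealogyPedigree

/-! ## §1 List lemmas over a sum type -/

section SumLists

variable {α β : Type*}

/-- a list over a sum type with duplicate-free left and right projections is duplicate-free [folklore] -/
theorem nodup_of_lefts_rights : ∀ {l : List (α ⊕ β)}, (lefts l).Nodup → (rights l).Nodup → l.Nodup
  | [], _, _ => List.nodup_nil
  | Sum.inl a :: l, hl, hr => by
      rw [lefts_cons_inl, List.nodup_cons] at hl
      rw [rights_cons_inl] at hr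
      refine List.nodup_cons.2 ⟨fun h => hl.1 ((mem_lefts_iff a l).2 h), nodup_of_lefts_rights hl.2 hr⟩
  | Sum.inr b :: l, hl, hr => by
      rw [rights_cons_inr, List.nodup_cons] at hr
      rw [lefts_cons_inr] at hl
      refine List.nodup_cons.2 ⟨fun h => hr.1 ((mem_rights_iff b l).2 h), nodup_of_lefts_rights hl hr.2⟩

/-- `lefts` of a list with no left entry is empty [folklore] -/
theorem lefts_eq_nil_of_forall_isRight : ∀ {l : List (α ⊕ β)}, (∀ x ∈ l, Sum.isRight x = true) → lefts l = []
  | [], _ => rfl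
  | Sum.inl a :: l, h => by simpa using h (Sum.inl a) List.mem_cons_self
  | Sum.inr b :: l, h => by
      rw [lefts_cons_inr]; exact lefts_eq_nil_of_forall_isRight fun x hx => h x (List.mem_cons_of_mem _ hx)

/-- a left entry of a list whose `lefts` is empty is impossible [folklore] -/
theorem not_inl_mem_of_lefts_eq_nil {l : List (α ⊕ β)} (h : lefts l = []) (a : α) : Sum.inl a ∉ l := fun hm => by
  have := (mem_lefts_iff a l).2 hm
  rw [h] at this
  simp at this

end SumLists

/-! ## §2 Constituents as parts, and the pedigree -/

section PedigreeOf

variable {γ : Type*}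

/-- **A CONSTITUENT OF A LEVEL-`(j+1)` COMPONENT AS A PART**: an old part `p` (a component of level `j`) with its
renewal flag `rnw j p` (renewed by the 𝐑-operation of level `j`, event dated `j + 1`); a new region `n` of step `j + 1`
with its class. [folklore] -/
def toPart (cls : γ → ℕ) (rnw : ℕ → γ → Bool) (j : ℕ) : γ ⊕ γ → Part (ℕ × γ) γ
  | Sum.inl p => Part.old (j, p) (rnw j p)
  | Sum.inr n => Part.new (cls n) n

/-- `toPart` of an old part [folklore] -/
@[simp] theorem toPart_inl (cls : γ → ℕ) (rnw : ℕ → γ → Bool) (j : ℕ) (p : γ) :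
    toPart cls rnw j (Sum.inl p) = Part.old (j, p) (rnw j p) := rfl

/-- `toPart` of a new region [folklore] -/
@[simp] theorem toPart_inr (cls : γ → ℕ) (rnw : ℕ → γ → Bool) (j : ℕ) (n : γ) :
    toPart cls rnw j (Sum.inr n) = Part.new (cls n) n := rfl

/-- an old part in the image of `toPart … j` is named `(j, p)` for a left entry `p` [folklore] -/
theorem exists_inl_of_old_mem_map {cls : γ → ℕ} {rnw : ℕ → γ → Bool} {j : ℕ} {l : List (γ ⊕ γ)} {c' : ℕ × γ}
    {r : Bool} (h : Part.old c' r ∈ l.map (toPart cls rnw j)) : ∃ p, Sum.inl p ∈ l ∧ c' = (j, p) ∧ r = rnw j p := by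
  obtain ⟨x, hx, hxe⟩ := List.mem_map.1 h
  cases x with
  | inl p =>
      rw [toPart_inl] at hxe
      obtain ⟨h1, h2⟩ := Part.old.inj hxe
      exact ⟨p, hx, h1.symm, h2.symm⟩
  | inr n => simp [toPart] at hxe

variable [DecidableEq γ] (H : ComponentHistory γ) (rnw : ℕ → γ → Bool) (ord : ℕ → γ → List (γ ⊕ γ))

/-- **THE PART LIST OF A NAMED COMPONENT** `(j, c)`: empty unless `c ∈ comp j`; at level `0` the births of the listed
new regions; at level `j + 1` the listed constituents read as parts. [folklore] -/
def partsOf : ℕ × γ → List (Part (ℕ × γ) γ)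
  | (0, c) => if c ∈ H.comp 0 then (rights (ord 0 c)).map (fun n => Part.new (H.cls n) n) else []
  | (j + 1, c) => if c ∈ H.comp (j + 1) then (ord (j + 1) c).map (toPart H.cls rnw j) else []

/-- the part list at level `0` of a component [folklore] -/
theorem partsOf_zero {c : γ} (hc : c ∈ H.comp 0) :
    partsOf H rnw ord (0, c) = (rights (ord 0 c)).map (fun n => Part.new (H.cls n) n) := by
  simp [partsOf, hc]

/-- the part list at a successor level of a component [folklore] -/
theorem partsOf_succ {j : ℕ} {c : γ} (hc : c ∈ H.comp (j + 1)) :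
    partsOf H rnw ord (j + 1, c) = (ord (j + 1) c).map (toPart H.cls rnw j) := by
  simp [partsOf, hc]

/-- the part list of a non-component is empty [folklore] -/
theorem partsOf_of_not_mem {j : ℕ} {c : γ} (hc : c ∉ H.comp j) : partsOf H rnw ord (j, c) = [] := by
  cases j <;> simp [partsOf, hc]

/-- an old part occurs only at successor levels, as `(j, p)` for a listed old constituent `p` of a component
[folklore] -/
theorem old_mem_partsOf {j : ℕ} {c : γ} {c' : ℕ × γ} {r : Bool} (h : Part.old c' r ∈ partsOf H rnw ord (j, c)) :
    ∃ j₀ p, j = j₀ + 1 ∧ c ∈ H.comp (j₀ + 1) ∧ Sum.inl p ∈ ord (j₀ + 1) c ∧ c' = (j₀, p) ∧ r = rnw j₀ p := by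
  cases j with
  | zero =>
      by_cases hc : c ∈ H.comp 0
      · rw [partsOf_zero H rnw ord hc] at h
        obtain ⟨n, -, hn⟩ := List.mem_map.1 h
        simp at hn
      · rw [partsOf_of_not_mem H rnw ord hc] at h; simp at h
  | succ j₀ =>
      by_cases hc : c ∈ H.comp (j₀ + 1)
      · rw [partsOf_succ H rnw ord hc] at h
        obtain ⟨p, hp, hc', hr⟩ := exists_inl_of_old_mem_map h
        exact ⟨j₀, p, rfl, hc, hp, hc', hr⟩
      · rw [partsOf_of_not_mem H rnw ord hc] at h; simp at h

/-- **THE PEDIGREE OF A COMPONENT HISTORY** (names `(level, label)`, payloads = labels of new regions, `step = level`).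
[folklore] -/
def pedOf : Pedigree (ℕ × γ) γ where
  step := Prod.fst
  parts := partsOf H rnw ord
  step_lt := by
    rintro ⟨j, c⟩ c' r h
    obtain ⟨j₀, p, rfl, -, -, rfl, -⟩ := old_mem_partsOf H rnw ord h
    exact Nat.lt_succ_self j₀

/-- the step of a name is its level [folklore] -/
@[simp] theorem step_pedOf (a : ℕ × γ) : (pedOf H rnw ord).step a = a.1 := rfl

/-- the parts of a name [folklore] -/
@[simp] theorem parts_pedOf (a : ℕ × γ) : (pedOf H rnw ord).parts a = partsOf H rnw ord a := rfl

/-! ## §3 The encoding facts: `renew_step`, `UniqueParent`, `OldNodup`, `Forest` -/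

/-- **`renew_step`**: a renewed old part is a component of the PREVIOUS step (the END's first encoding field, for every
name). [folklore] -/
theorem renew_step_pedOf (c c' : ℕ × γ) (h : Part.old c' true ∈ (pedOf H rnw ord).parts c) :
    (pedOf H rnw ord).step c' + 1 = (pedOf H rnw ord).step c := by
  obtain ⟨j, x⟩ := c
  obtain ⟨j₀, p, rfl, -, -, rfl, -⟩ := old_mem_partsOf H rnw ord h
  rfl

/-- an old part of ANY flag dates from the previous step [folklore] -/
theorem step_old_pedOf {c c' : ℕ × γ} {r : Bool} (h : Part.old c' r ∈ (pedOf H rnw ord).parts c) :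
    (pedOf H rnw ord).step c' + 1 = (pedOf H rnw ord).step c := by
  obtain ⟨j, x⟩ := c
  obtain ⟨j₀, p, rfl, -, -, rfl, -⟩ := old_mem_partsOf H rnw ord h
  rfl

/-- **THE DISPLAYED HYPOTHESIS ON THE ORDER**: the chosen order lists exactly the constituents of every component (a
permutation of `constit`). [folklore] -/
def OrderOK : Prop := ∀ j c, c ∈ H.comp j → (ord j c).Perm (H.constit j c)

variable {H rnw ord}

omit [DecidableEq γ] in
/-- under an admissible order, a listed old constituent is a part of print's bookkeeping [folklore] -/
theorem mem_parts_of_inl_mem_ord (hO : OrderOK H ord) {j : ℕ} {c p : γ} (hc : c ∈ H.comp j)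
    (hp : Sum.inl p ∈ ord j c) : p ∈ H.parts j c :=
  (mem_lefts_iff p _).2 ((hO j c hc).mem_iff.1 hp)

omit [DecidableEq γ] in
/-- under an admissible order, a listed new constituent is a new region of print's bookkeeping [folklore] -/
theorem mem_news_of_inr_mem_ord (hO : OrderOK H ord) {j : ℕ} {c n : γ} (hc : c ∈ H.comp j)
    (hn : Sum.inr n ∈ ord j c) : n ∈ H.news j c :=
  (mem_rights_iff n _).2 ((hO j c hc).mem_iff.1 hn)

/-- under `WF` the constituent list of print's bookkeeping is duplicate-free [folklore] -/
theorem nodup_constit (hW : H.WF) (j : ℕ) (c : γ) : (H.constit j c).Nodup :=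
  nodup_of_lefts_rights (hW.parts_nodup j c) (hW.news_nodup j c)

/-- under `WF` and an admissible order, the chosen order is duplicate-free [folklore] -/
theorem nodup_ord (hW : H.WF) (hO : OrderOK H ord) {j : ℕ} {c : γ} (hc : c ∈ H.comp j) : (ord j c).Nodup :=
  (hO j c hc).nodup_iff.2 (nodup_constit hW j c)

/-- **UNIQUE PARENTS**: an old name occurs in the part list of at most one component (`WF.parts_disj`: distinct
components continue disjoint sets of old components). [folklore] -/
theorem uniqueParent_pedOf (hW : H.WF) (hO : OrderOK H ord) : (pedOf H rnw ord).UniqueParent := by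
  rintro ⟨j, x⟩ ⟨j', x'⟩ d r r' hd hd'
  obtain ⟨j₀, p, rfl, hx, hp, rfl, -⟩ := old_mem_partsOf H rnw ord hd
  obtain ⟨j₁, p', hj, hx', hp', hpp, -⟩ := old_mem_partsOf H rnw ord hd'
  obtain ⟨rfl, rfl⟩ := Prod.mk.inj hpp
  subst hj
  by_contra hne
  have hne' : x ≠ x' := fun h => hne (by rw [h])
  have hdis := hW.parts_disj j₀ x x' hx hx' hne'
  exact Finset.disjoint_left.1 hdis (List.mem_toFinset.2 (mem_parts_of_inl_mem_ord hO hx hp))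
    (List.mem_toFinset.2 (mem_parts_of_inl_mem_ord hO hx' hp'))

/-- **NO REPEATED CONSTITUENT**: two old parts at different positions of a part list have different names.
[folklore] -/
theorem oldNodup_pedOf (hW : H.WF) (hO : OrderOK H ord) (c : ℕ × γ) : (pedOf H rnw ord).OldNodup c := by
  obtain ⟨j, x⟩ := c
  unfold Pedigree.OldNodup
  rw [parts_pedOf]
  cases j with
  | zero =>
      by_cases hx : x ∈ H.comp 0
      · rw [partsOf_zero H rnw ord hx, List.pairwise_map]
        exact List.pairwise_of_forall fun a b c₁ r₁ c₂ r₂ h₁ _ => by simp at h₁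
      · rw [partsOf_of_not_mem H rnw ord hx]; exact List.Pairwise.nil
  | succ j₀ =>
      by_cases hx : x ∈ H.comp (j₀ + 1)
      · rw [partsOf_succ H rnw ord hx, List.pairwise_map]
        have hnd : (ord (j₀ + 1) x).Pairwise (fun a b => a ≠ b) := nodup_ord hW hO hx
        refine hnd.imp_of_mem ?_
        intro a b _ _ hab c₁ r₁ c₂ r₂ h₁ h₂
        cases a with
        | inr n => simp [toPart] at h₁
        | inl p =>
          cases b with
          | inr n => simp [toPart] at h₂
          | inl q =>
            rw [toPart_inl] at h₁ h₂
            have e₁ := (Part.old.inj h₁).1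
            have e₂ := (Part.old.inj h₂).1
            rw [← e₁, ← e₂]
            intro hpq
            exact hab (by rw [(Prod.mk.inj hpq).2])
      · rw [partsOf_of_not_mem H rnw ord hx]; exact List.Pairwise.nil

/-- **THE PEDIGREE IS A FOREST** at every name (the END's second encoding field). [folklore] -/
theorem forest_pedOf (hW : H.WF) (hO : OrderOK H ord) (c : ℕ × γ) : (pedOf H rnw ord).Forest c :=
  Pedigree.forest_of_uniqueParent (uniqueParent_pedOf hW hO) (oldNodup_pedOf hW hO) c

end PedigreeOf

/-! ## §4 The `PGen` of a name: one-step unfoldings in print's trichotomy -/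

section Unfold

variable {γ δ : Type*} [DecidableEq γ] [Inhabited δ] (H : ComponentHistory γ) (rnw : ℕ → γ → Bool)
  (ord : ℕ → γ → List (γ ⊕ γ)) (cell : γ → δ)

/-- the `PGen` of a part at a successor level: an old unflagged part ↦ its own `PGen`; an old flagged part ↦ renewed
at its level; a new region ↦ born at the component's level [folklore] -/
theorem partPGen_toPart (j : ℕ) (x : γ) (q : γ ⊕ γ) :
    (pedOf H rnw ord).partPGen cell (j + 1, x) ((pedOf H rnw ord).toPGen cell) (toPart H.cls rnw j q) =
      Sum.elim (fun p => if rnw j p = true then PGen.renew ((pedOf H rnw ord).toPGen cell (j, p)) j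
          else (pedOf H rnw ord).toPGen cell (j, p))
        (fun n => PGen.birth (j + 1) (H.cls n) (cell n)) q := by
  cases q with
  | inl p =>
      rw [toPart_inl]
      cases h : rnw j p <;> simp [Pedigree.partPGen, h]
  | inr n => rfl

/-- **THE `PGen` OF A COMPONENT AT A SUCCESSOR LEVEL, UNFOLDED**: the left-nested join (`joinP`) of the parts' `PGen`s.
[folklore] -/
theorem toPGen_succ {j : ℕ} {c : γ} (hc : c ∈ H.comp (j + 1)) :
    (pedOf H rnw ord).toPGen cell (j + 1, c) =
      (pedOf H rnw ord).joinP (j + 1, c) ((ord (j + 1) c).map fun q =>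
        Sum.elim (fun p => if rnw j p = true then PGen.renew ((pedOf H rnw ord).toPGen cell (j, p)) j
            else (pedOf H rnw ord).toPGen cell (j, p))
          (fun n => PGen.birth (j + 1) (H.cls n) (cell n)) q) := by
  rw [Pedigree.toPGen_eq, parts_pedOf, partsOf_succ H rnw ord hc, List.map_map]
  congr 1
  refine List.map_congr_left fun q _ => ?_
  exact partPGen_toPart H rnw ord cell j c q

/-- the `PGen` of a component at level `0`, unfolded: the left-nested join of the births of its listed new regions
[folklore] -/
theorem toPGen_zero {c : γ} (hc : c ∈ H.comp 0) :
    (pedOf H rnw ord).toPGen cell (0, c) =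
      (pedOf H rnw ord).joinP (0, c) ((rights (ord 0 c)).map fun n => PGen.birth 0 (H.cls n) (cell n)) := by
  rw [Pedigree.toPGen_eq, parts_pedOf, partsOf_zero H rnw ord hc, List.map_map]
  rfl

/-- **LONE UNFLAGGED PART** (no event, (1.83)): the part's own `PGen` [folklore] -/
theorem toPGen_succ_lone {j : ℕ} {c p : γ} (hc : c ∈ H.comp (j + 1)) (hp : ord (j + 1) c = [Sum.inl p])
    (hr : rnw j p = false) : (pedOf H rnw ord).toPGen cell (j + 1, c) = (pedOf H rnw ord).toPGen cell (j, p) := by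
  rw [toPGen_succ H rnw ord cell hc, hp]
  simp [Pedigree.joinP, chainJoin, hr]

/-- **LONE FLAGGED PART** (renewed by the 𝐑-operation of level `j`, event at `j + 1`): `renew _ j` [folklore] -/
theorem toPGen_succ_renew {j : ℕ} {c p : γ} (hc : c ∈ H.comp (j + 1)) (hp : ord (j + 1) c = [Sum.inl p])
    (hr : rnw j p = true) :
    (pedOf H rnw ord).toPGen cell (j + 1, c) = PGen.renew ((pedOf H rnw ord).toPGen cell (j, p)) j := by
  rw [toPGen_succ H rnw ord cell hc, hp]
  simp [Pedigree.joinP, chainJoin, hr]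

/-- **LONE NEW REGION** at a successor level: born there [folklore] -/
theorem toPGen_succ_birth {j : ℕ} {c n : γ} (hc : c ∈ H.comp (j + 1)) (hn : ord (j + 1) c = [Sum.inr n]) :
    (pedOf H rnw ord).toPGen cell (j + 1, c) = PGen.birth (j + 1) (H.cls n) (cell n) := by
  rw [toPGen_succ H rnw ord cell hc, hn]
  simp [Pedigree.joinP, chainJoin]

/-- lone new region at level `0` [folklore] -/
theorem toPGen_zero_birth {c n : γ} (hc : c ∈ H.comp 0) (hn : rights (ord 0 c) = [n]) :
    (pedOf H rnw ord).toPGen cell (0, c) = PGen.birth 0 (H.cls n) (cell n) := by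
  rw [toPGen_zero H rnw ord cell hc, hn]
  simp [Pedigree.joinP, chainJoin]

/-- **A COMPONENT WITH AT LEAST TWO CONSTITUENTS** at a successor level: the left-nested join chain at the level, headed
by the first listed constituent [folklore] -/
theorem toPGen_succ_chain {j : ℕ} {c : γ} (hc : c ∈ H.comp (j + 1)) {q₀ q₁ : γ ⊕ γ} {qs : List (γ ⊕ γ)}
    (h : ord (j + 1) c = q₀ :: q₁ :: qs) :
    (pedOf H rnw ord).toPGen cell (j + 1, c) =
      chainJoin
        (Sum.elim (fun p => if rnw j p = true then PGen.renew ((pedOf H rnw ord).toPGen cell (j, p)) j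
            else (pedOf H rnw ord).toPGen cell (j, p)) (fun n => PGen.birth (j + 1) (H.cls n) (cell n)) q₀)
        ((q₁ :: qs).map fun q =>
          Sum.elim (fun p => if rnw j p = true then PGen.renew ((pedOf H rnw ord).toPGen cell (j, p)) j
              else (pedOf H rnw ord).toPGen cell (j, p)) (fun n => PGen.birth (j + 1) (H.cls n) (cell n)) q)
        (j + 1) := by
  rw [toPGen_succ H rnw ord cell hc, h]
  rfl

end Unfold

end Summit.QuantumFields.BalabanUV.T4Continuum.HistoryGenealogyPedigree
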